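import Literature.NumberTheory.QuadraticFields.CubicClassFieldNormal
import Literature.NumberTheory.NumberFields.UnramifiedCyclicOddDegreeArtinMap
import Literature.NumberTheory.CubicFields.CubicResolventCharacter
import HarnessLib

/-!
# The unramified cyclic cubic extensions of a number field are the class fields of the index-`3` subgroups of its class group

Topic `Literature/NumberTheory/CubicFields` (class field theory of Hasse's count of cubic fields).
Theorem-only file (no definition, no named fact, D-0026), unconditional on the tree's PROVED class
field theory:

* existence and Artin reciprocity for the class fields of the characters of `Cl(𝓞_k)`
  (`NumberFields/ClassFieldsOfIndexThree.lean`: `exists_isCubicClassField`, `eq_of_isCubicClassField`);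
* the Artin map `Cl(𝓞_k) ↠ Gal(E/k)` of an unramified cyclic extension of odd degree
  (`NumberFields/UnramifiedCyclicOddDegreeArtinMap.lean`, the square trick disposing of the real places);
* uniqueness of the field carrying class field data with given kernel
  (`QuadraticFields/CubicClassFieldNormal.lean`: `eq_of_frobData`, Bauer's theorem).

For a number field `k` let `𝓔(k)` be the set of intermediate fields `E` of `k̄/k` which are Galois
of degree `3` over `k` and unramified at every finite prime of `k` (written out as a set-builder in
the statements; no definition is introduced).  Then:

* `exists_mem_frobData_of_index_eq_three` — every subgroup `S ≤ Cl(𝓞_k)` of index `3` has a class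
  field `E_S ∈ 𝓔(k)` carrying class field data `(ψ, χ)` with `ker ψ = S`;
* `exists_frobData_of_mem` — conversely every `E ∈ 𝓔(k)` carries class field data `(ψ, χ)` with
  `ker ψ` of index `3` (`ψ = χ ∘ Φ_E` for the Artin map `Φ_E`);
* `natCard_unramifiedCubic_eq` — hence **`#𝓔(k) = #{S ≤ Cl(𝓞_k) : [Cl : S] = 3}`**
  `= (#Cl(𝓞_k)[3] − 1)/2`: `S ↦ E_S` is a bijection (injective by `eq_of_isCubicClassField`,
  surjective by `eq_of_frobData`).

This is the class-field-theoretic half ("index-`3` subgroups of `Cl(ℚ(√D))` ↔ unramified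
`C₃`-extensions of `ℚ(√D)`") of the dictionary `#Cl₃(D) = 2 · #{cubic fields of discriminant D} + 1`
(Hasse 1930; Davenport–Heilbronn 1971 §6; Bhargava–Shankar–Tsimerman §8.5: "by class field theory
the number of triplets of cubic fields `K₃` corresponding to a given `K₂` … equals `(h₃*(K₂) − 1)/2`";
Washington, *Cyclotomic Fields*, proof of Thm. 10.10: "the `3`-rank of the class group equals the
number of independent unramified cyclic cubic extensions"), valid here for every number field `k`.

## References

* H. Hasse, *Arithmetische Theorie der kubischen Zahlkörper auf klassenkörpertheoretischer
  Grundlage*, Math. Z. 31 (1930) 565–582. [Hasse1930]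
* M. Bhargava, A. Shankar, J. Tsimerman, Invent. Math. 193 (2013) = arXiv:1005.0672, §8.5.
  [BhargavaShankarTsimerman2012]
* L. C. Washington, *Introduction to Cyclotomic Fields*, GTM 83 (1997), Thm. 10.10 (proof).
  [Washington1997]
* J. Neukirch, *Algebraic Number Theory* (1999), Ch. VI (6.9), (7.1); Ch. VII (13.9). [NeukirchANT1999]
-/

noncomputable section

open NumberField IsDedekindDomain Module
open scoped nonZeroDivisors IsMulCommutative

namespace Literature.NumberTheory.CubicFields

open Literature.NumberTheory.NumberFields Literature.NumberTheory.QuadraticFields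
  Literature.NumberTheory.GaloisRepresentations

variable {k : Type} [Field k] [NumberField k]

/-! ### The class fields of the index-`3` subgroups -/

/-- **The class field of an index-`3` subgroup is an unramified cyclic cubic extension carrying
class field data** (`exists_isCubicClassField`, repackaged): for `S ≤ Cl(𝓞_k)` of index `3` there
is `E ⊆ k̄`, Galois of degree `3` over `k` and unramified at every finite prime, with a character `ψ`
of `Cl(𝓞_k)` of kernel `S` and an injective character `χ` of `Gal(E/k)` such that
`χ(Frob_Q) = ψ([v])` for every Frobenius at every prime `Q ∣ v`.
[cite: Washington1997, Thm 10.10 (proof)] [cite: NeukirchANT1999, Ch. VI §6 (6.9) and §7 (7.1)] -/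
theorem exists_mem_frobData_of_index_eq_three {S : Subgroup (ClassGroup (𝓞 k))} (hS : S.index = 3) :
    ∃ E : IntermediateField k (AlgebraicClosure k),
      E ∈ {E : IntermediateField k (AlgebraicClosure k) | IsGalois k E ∧ finrank k E = 3 ∧
        ∀ v : HeightOneSpectrum (𝓞 k), Algebra.IsUnramifiedIn (𝓞 E) v.asIdeal} ∧
      ∃ (_ : FiniteDimensional k E) (_ : IsGalois k E) (ψ : ClassGroup (𝓞 k) →* ℂˣ)
        (χ : (E ≃ₐ[k] E) →* ℂˣ), ψ.ker = S ∧ Function.Injective χ ∧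
        ∀ (v : HeightOneSpectrum (𝓞 k)) (Q : Ideal (𝓞 E)), Q ∈ v.asIdeal.primesOver (𝓞 E) →
          ∀ φ : E ≃ₐ[k] E, IsArithFrobAt (𝓞 k) φ Q →
            χ φ = ψ (ClassGroup.mk0 ⟨v.asIdeal, asIdeal_mem_nonZeroDivisors v⟩) := by
  obtain ⟨E, hfd, hgal, h3, hunr, ψ, χ, hψ, hχ, hfrob⟩ := exists_isCubicClassField hS
  exact ⟨E, ⟨hgal, h3, hunr⟩, hfd, hgal, ψ, χ, hψ, hχ, hfrob⟩

/-! ### Conversely: the Artin map of an unramified cyclic cubic extension -/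

/-- **An unramified cyclic cubic extension carries class field data for a subgroup of index `3`.**
If `E ⊆ k̄` is Galois of degree `3` over `k` and unramified at every finite prime, then with the
Artin map `Φ : Cl(𝓞_k) ↠ Gal(E/k)`, `Φ([𝔭]) = Frob_𝔭` (odd degree: no condition at the real
places, `exists_classGroup_monoidHom_surjective_galFrob_of_odd`) and an injective character `χ` of
`Gal(E/k) ≅ C₃`, the pair `(ψ, χ) = (χ ∘ Φ, χ)` is class field data on `E` and `ker ψ = ker Φ` has
index `3`. [cite: NeukirchANT1999, Ch. VI §7 (7.1)] [cite: BhargavaShankarTsimerman2012, §8.5] -/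
theorem exists_frobData_of_mem {E : IntermediateField k (AlgebraicClosure k)}
    (hE : E ∈ {E : IntermediateField k (AlgebraicClosure k) | IsGalois k E ∧ finrank k E = 3 ∧
      ∀ v : HeightOneSpectrum (𝓞 k), Algebra.IsUnramifiedIn (𝓞 E) v.asIdeal}) :
    ∃ (_ : FiniteDimensional k E) (_ : IsGalois k E) (S : Subgroup (ClassGroup (𝓞 k)))
      (ψ : ClassGroup (𝓞 k) →* ℂˣ) (χ : (E ≃ₐ[k] E) →* ℂˣ),
      S.index = 3 ∧ ψ.ker = S ∧ Function.Injective χ ∧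
        ∀ (v : HeightOneSpectrum (𝓞 k)) (Q : Ideal (𝓞 E)), Q ∈ v.asIdeal.primesOver (𝓞 E) →
          ∀ φ : E ≃ₐ[k] E, IsArithFrobAt (𝓞 k) φ Q →
            χ φ = ψ (ClassGroup.mk0 ⟨v.asIdeal, asIdeal_mem_nonZeroDivisors v⟩) := by
  classical
  obtain ⟨hgal, h3, hunr⟩ := hE
  haveI : FiniteDimensional k E := Module.finite_of_finrank_eq_succ h3
  haveI := hgal
  haveI : FiniteDimensional ℚ E := Module.Finite.trans k E
  haveI : CharZero E := charZero_of_injective_algebraMap (algebraMap k E).injective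
  haveI : NumberField E := NumberField.mk
  have hcard : Nat.card (E ≃ₐ[k] E) = 3 := by rw [IsGalois.card_aut_eq_finrank, h3]
  haveI : Fact (Nat.Prime 3) := ⟨Nat.prime_three⟩
  haveI : IsCyclic (E ≃ₐ[k] E) := isCyclic_of_prime_card hcard
  haveI : IsAbelianGalois k E := {}
  obtain ⟨χ, hχ⟩ := exists_injective_character E hcard
  have hodd : Odd (finrank k E) := by rw [h3]; exact ⟨1, rfl⟩
  obtain ⟨Φ, hΦsurj, hΦ⟩ := exists_classGroup_monoidHom_surjective_galFrob_of_odd k E hodd hunr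
  refine ⟨inferInstance, hgal, Φ.ker, χ.comp Φ, χ, ?_, ?_, hχ, ?_⟩
  · rw [Subgroup.index_ker, MonoidHom.range_eq_top.mpr hΦsurj, Subgroup.card_top, hcard]
  · ext c
    rw [MonoidHom.mem_ker, MonoidHom.mem_ker, MonoidHom.comp_apply, map_eq_one_iff χ hχ]
  · intro v Q hQ φ hφ
    have hcomm := commute_of_isCyclic_gal k E
    rw [eq_galFrob hcomm (hunr v) hQ hφ, MonoidHom.comp_apply, ← hΦ v]

/-! ### The count -/

/-- Transport of class field data along an equality of intermediate fields. [folklore] -/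
theorem exists_frobData_of_eq {E E' : IntermediateField k (AlgebraicClosure k)} (h : E = E')
    [FiniteDimensional k E'] [IsGalois k E'] {ψ : ClassGroup (𝓞 k) →* ℂˣ}
    {χ' : (E' ≃ₐ[k] E') →* ℂˣ} (hχ' : Function.Injective χ')
    (hfrob' : ∀ (v : HeightOneSpectrum (𝓞 k)) (Q : Ideal (𝓞 E')), Q ∈ v.asIdeal.primesOver (𝓞 E') →
      ∀ φ : E' ≃ₐ[k] E', IsArithFrobAt (𝓞 k) φ Q →
        χ' φ = ψ (ClassGroup.mk0 ⟨v.asIdeal, asIdeal_mem_nonZeroDivisors v⟩)) :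
    ∃ χ : (E ≃ₐ[k] E) →* ℂˣ, Function.Injective χ ∧
      ∀ (v : HeightOneSpectrum (𝓞 k)) (Q : Ideal (𝓞 E)), Q ∈ v.asIdeal.primesOver (𝓞 E) →
        ∀ φ : E ≃ₐ[k] E, IsArithFrobAt (𝓞 k) φ Q →
          χ φ = ψ (ClassGroup.mk0 ⟨v.asIdeal, asIdeal_mem_nonZeroDivisors v⟩) := by
  subst h
  exact ⟨χ', hχ', hfrob'⟩

/-- **`#𝓔(k) = #{S ≤ Cl(𝓞_k) : [Cl(𝓞_k) : S] = 3}`**: the unramified cyclic cubic extensions of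
`k` inside `k̄` are in bijection with the index-`3` subgroups of the class group, `S ↦ E_S` (the
class field of `S`): injective because a field carrying class field data for `S` and for `T` has
`S = T` (`eq_of_isCubicClassField`), surjective because every `E ∈ 𝓔(k)` carries class field data
for `ker Φ_E` (`exists_frobData_of_mem`) and a field carrying class field data is determined by the
kernel (`eq_of_frobData`, Bauer).  With `#Cl₃ = 2 · #{index-3 subgroups} + 1`
(`ThreeTorsionProofs`) this is "`#{unramified C₃-extensions} = (h₃* − 1)/2`" (BST §8.5; Washington
Thm. 10.10). [cite: BhargavaShankarTsimerman2012, §8.5] [cite: Washington1997, Thm 10.10 (proof)] -/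
theorem natCard_unramifiedCubic_eq :
    Nat.card {E : IntermediateField k (AlgebraicClosure k) | IsGalois k E ∧ finrank k E = 3 ∧
        ∀ v : HeightOneSpectrum (𝓞 k), Algebra.IsUnramifiedIn (𝓞 E) v.asIdeal} =
      Nat.card {S : Subgroup (ClassGroup (𝓞 k)) // S.index = 3} := by
  classical
  choose E hEmem hEfd hEgal ψ χ hker hχ hfrob using
    fun S : {S : Subgroup (ClassGroup (𝓞 k)) // S.index = 3} =>
      exists_mem_frobData_of_index_eq_three (k := k) S.2
  set f : {S : Subgroup (ClassGroup (𝓞 k)) // S.index = 3} →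
      {E : IntermediateField k (AlgebraicClosure k) | IsGalois k E ∧ finrank k E = 3 ∧
        ∀ v : HeightOneSpectrum (𝓞 k), Algebra.IsUnramifiedIn (𝓞 E) v.asIdeal} :=
    fun S => ⟨E S, hEmem S⟩ with hf
  symm
  refine Nat.card_eq_of_bijective f ⟨?_, ?_⟩
  · -- injective: class field data for `S` and for `T` on the same field
    intro S T hST
    have hEST : E S = E T := congrArg Subtype.val hST
    haveI := hEfd S
    haveI := hEgal S
    haveI := hEfd T
    haveI := hEgal T
    have hm : IsGalois k (E S) ∧ finrank k (E S) = 3 ∧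
        ∀ v : HeightOneSpectrum (𝓞 k), Algebra.IsUnramifiedIn (𝓞 (E S)) v.asIdeal := hEmem S
    obtain ⟨-, h3, -⟩ := hm
    obtain ⟨χ', hχ', hfrob'⟩ := exists_frobData_of_eq hEST (hχ T) (hfrob T)
    exact Subtype.ext (eq_of_isCubicClassField h3 (hker S) (hχ S) (hfrob S) (hker T) hfrob' S.2 T.2)
  · -- surjective: every `E₀ ∈ 𝓔(k)` is the class field of `ker Φ_{E₀}`
    rintro ⟨E₀, hE₀⟩
    obtain ⟨hfd₀, hgal₀, S, ψ₀, χ₀, hS, hker₀, hχ₀, hfrob₀⟩ := exists_frobData_of_mem hE₀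
    haveI := hfd₀
    haveI := hgal₀
    haveI := hEfd ⟨S, hS⟩
    haveI := hEgal ⟨S, hS⟩
    have hm₀ : IsGalois k E₀ ∧ finrank k E₀ = 3 ∧
        ∀ v : HeightOneSpectrum (𝓞 k), Algebra.IsUnramifiedIn (𝓞 E₀) v.asIdeal := hE₀
    obtain ⟨-, -, hunr₀⟩ := hm₀
    refine ⟨⟨S, hS⟩, Subtype.ext ?_⟩
    change E ⟨S, hS⟩ = E₀
    exact eq_of_frobData hunr₀ hχ₀ hfrob₀ (hχ ⟨S, hS⟩) (hfrob ⟨S, hS⟩) (by rw [hker₀, hker])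

end Literature.NumberTheory.CubicFields

end
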